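import Summits.Ventures.Crystal3D.Theorems.StickyWulffConstantGenericWallFloorStackWalkForcedChain
import HarnessLib

/-!
# SWEPT STEERING: a steering vector that selects an adjacent capper, and the forced next normal of an in-plane capper
# (crux `GenericWallFloor`, stmt-Ventures-19480, line `WallLedgerG`; memo RISER-LEDGER-g8 §4, HOME/wall-p1-g8/)

HONEST FRAMING. Venture `Summits/Ventures/Crystal3D` (cell `crystal3d-full`), helper `--supports` the crux
`GenericWallFloor` of `route-Ventures-StickyWulffConstant`, REGISTERED line `WallLedgerG`, open stub
`stub_twoSlabAdhesion`.  Structure only (census-free, inner products only); F-C1 not moved; NOT the crux, no ledger here.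

THE MECHANISM (memo RISER-LEDGER-g8 §4).  The stack walk's theorems (`walkInv_start`, `walkStep_spec`, `stackWalk_end`)
hold for ANY unit steering vector `z` as long as the family slot is `z`-steep.  On the registered residual (the `Σ9` cap)
the VERTICAL steering makes the forced ray of a steep family (`…StackWalkForcedChain`: after the first push across `n` the
next push is across `nextNormal = 2√(2/3)·F q − n`) run `A₂ → T → R_{μ_far}T = far lattice`, i.e. the walkers ARRIVE; the
ray is decided by WHICH capper `q` the steering selects at the first push.  This file isolates the two census-free
hinges of choosing the capper:
* **`inner_swept_steering_self` / `sqrt_two_div_two_le_inner_swept_steering` / `inner_lt_of_swept_steering`** — for a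
  unit incoming direction `v` and a unit capper `c` with `⟪v, c⟫ = 5/6` (an ADJACENT capper: the incoming slot and the
  twin frame's positive slots adjacent to it make this angle) the SWEPT STEERING `z′ = (v + c)/‖v + c‖` is a unit vector,
  keeps `v` steep (`⟪v, z′⟫ = ⟪c, z′⟫ = √(11/12) ≥ √2/2`), and every other candidate `q` with `⟪q, v⟫ ≤ 5/6` and
  `⟪q, c⟫ ≤ 1/2` (the other two cappers: `60°` from `c`, adjacent or far from `v`) has `⟪q, z′⟫ < ⟪c, z′⟫`;
* **`bestCapper_eq_of_strict`** — a positive slot that strictly beats every other positive slot in `z`-height IS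
  `bestCapper` (the choice in `bestCapper` is then forced); with the previous item: the swept steering SELECTS `c`
  (`bestCapper_eq_of_swept_steering`);
* **`inner_dir_nextNormal`**, **`nextNormal_ne_of_inner_eq_zero`**, **`nextNormal_ne_neg_of_inner_eq_zero`** — the forced
  next normal of an entry `e` satisfies `⟪F d, nextNormal e⟫ = √(2/3)` (for `‖F d‖ = 1`, `⟪F d, n⟫ = √(2/3)`), so if the
  selected capper `d` lies IN the mirror plane of a normal `m` (`⟪F d, m⟫ = 0`) then `nextNormal e ≠ ± m`: the ray's next
  mirror is NOT across `m`.  On the cap: the diagonal capper is `μ_far`-in-plane, so the swept ray is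
  `A₂ → T → R_{μ₃}T → …`, never the far lattice (0 arrivals in the exact simulation, memo §4/§6).
WHAT THIS IS NOT: no walk is run, no ledger, no claim about which cappers are adjacent/in-plane for a given pair (a
finite frame computation per cell); F-C1 not moved.
-/

noncomputable section

namespace Summit.Ventures.Crystal3D.Theorems

open Finset
open scoped InnerProductSpace

/-! ### The swept steering vector -/

/-- `‖v + c‖² = 11/3` for unit `v`, `c` with `⟪v, c⟫ = 5/6`. -/
theorem norm_add_sq_of_adjacent {v c : EuclideanSpace ℝ (Fin 3)} (hv : ‖v‖ = 1) (hc : ‖c‖ = 1)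
    (hvc : ⟪v, c⟫_ℝ = 5 / 6) : ‖v + c‖ ^ 2 = 11 / 3 := by
  have hcv : ⟪c, v⟫_ℝ = 5 / 6 := by rw [real_inner_comm]; exact hvc
  rw [← real_inner_self_eq_norm_sq, inner_add_left, inner_add_right, inner_add_right, real_inner_self_eq_norm_sq,
    real_inner_self_eq_norm_sq, hv, hc, hvc, hcv]
  norm_num

/-- `v + c ≠ 0` and `‖v + c‖ > 0` for an adjacent pair. -/
theorem norm_add_pos_of_adjacent {v c : EuclideanSpace ℝ (Fin 3)} (hv : ‖v‖ = 1) (hc : ‖c‖ = 1)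
    (hvc : ⟪v, c⟫_ℝ = 5 / 6) : 0 < ‖v + c‖ := by
  have h := norm_add_sq_of_adjacent hv hc hvc
  have h0 : 0 ≤ ‖v + c‖ := norm_nonneg _
  nlinarith

/-- **The swept steering is a unit vector**: `‖(v + c)/‖v + c‖‖ = 1`. -/
theorem norm_swept_steering {v c : EuclideanSpace ℝ (Fin 3)} (hv : ‖v‖ = 1) (hc : ‖c‖ = 1)
    (hvc : ⟪v, c⟫_ℝ = 5 / 6) : ‖(‖v + c‖⁻¹ : ℝ) • (v + c)‖ = 1 := by
  have hpos := norm_add_pos_of_adjacent hv hc hvc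
  rw [norm_smul, Real.norm_of_nonneg (inv_nonneg.2 hpos.le), inv_mul_cancel₀ hpos.ne']

/-- **The incoming direction and the selected capper have the same `z′`-height `‖v + c‖/2`.** -/
theorem inner_swept_steering_self {v c : EuclideanSpace ℝ (Fin 3)} (hv : ‖v‖ = 1) (hc : ‖c‖ = 1)
    (hvc : ⟪v, c⟫_ℝ = 5 / 6) :
    ⟪v, (‖v + c‖⁻¹ : ℝ) • (v + c)⟫_ℝ = ‖v + c‖ / 2 ∧ ⟪c, (‖v + c‖⁻¹ : ℝ) • (v + c)⟫_ℝ = ‖v + c‖ / 2 := by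
  have hpos := norm_add_pos_of_adjacent hv hc hvc
  have hsq := norm_add_sq_of_adjacent hv hc hvc
  have hvv : ⟪v, v⟫_ℝ = 1 := by rw [real_inner_self_eq_norm_sq, hv, one_pow]
  have hcc : ⟪c, c⟫_ℝ = 1 := by rw [real_inner_self_eq_norm_sq, hc, one_pow]
  have hcv : ⟪c, v⟫_ℝ = 5 / 6 := by rw [real_inner_comm]; exact hvc
  have key : ∀ t : ℝ, t = 11 / 6 → ‖v + c‖⁻¹ * t = ‖v + c‖ / 2 := by
    intro t ht
    rw [ht]
    field_simp
    nlinarith [hsq]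
  constructor
  · rw [real_inner_smul_right, inner_add_right, hvv, hvc]; exact key _ (by norm_num)
  · rw [real_inner_smul_right, inner_add_right, hcv, hcc]; exact key _ (by norm_num)

/-- **The incoming slot stays steep for the swept steering**: `√2/2 ≤ ⟪v, z′⟫` (indeed `⟪v, z′⟫ = √(11/12)`). -/
theorem sqrt_two_div_two_le_inner_swept_steering {v c : EuclideanSpace ℝ (Fin 3)} (hv : ‖v‖ = 1) (hc : ‖c‖ = 1)
    (hvc : ⟪v, c⟫_ℝ = 5 / 6) : Real.sqrt 2 / 2 ≤ ⟪v, (‖v + c‖⁻¹ : ℝ) • (v + c)⟫_ℝ := by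
  rw [(inner_swept_steering_self hv hc hvc).1]
  have hsq := norm_add_sq_of_adjacent hv hc hvc
  have hpos := norm_add_pos_of_adjacent hv hc hvc
  have h2 : Real.sqrt 2 / 2 = Real.sqrt (1 / 2) := by
    rw [show (1 / 2 : ℝ) = 2 / (2 * 2) by norm_num, Real.sqrt_div' _ (by norm_num : (0 : ℝ) ≤ 2 * 2),
      Real.sqrt_mul_self (by norm_num : (0 : ℝ) ≤ 2)]
  have h3 : ‖v + c‖ / 2 = Real.sqrt (11 / 12) := by
    rw [eq_comm, Real.sqrt_eq_iff_mul_self_eq (by norm_num) (by linarith)]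
    nlinarith [hsq]
  rw [h2, h3]
  exact Real.sqrt_le_sqrt (by norm_num)

/-- **Every other candidate is strictly lower**: if `⟪q, v⟫ ≤ 5/6` and `⟪q, c⟫ ≤ 1/2` then `⟪q, z′⟫ < ⟪c, z′⟫`. -/
theorem inner_lt_of_swept_steering {v c q : EuclideanSpace ℝ (Fin 3)} (hv : ‖v‖ = 1) (hc : ‖c‖ = 1)
    (hvc : ⟪v, c⟫_ℝ = 5 / 6) (hqv : ⟪q, v⟫_ℝ ≤ 5 / 6) (hqc : ⟪q, c⟫_ℝ ≤ 1 / 2) :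
    ⟪q, (‖v + c‖⁻¹ : ℝ) • (v + c)⟫_ℝ < ⟪c, (‖v + c‖⁻¹ : ℝ) • (v + c)⟫_ℝ := by
  have hpos := norm_add_pos_of_adjacent hv hc hvc
  have hcc : ⟪c, c⟫_ℝ = 1 := by rw [real_inner_self_eq_norm_sq, hc, one_pow]
  have hcv : ⟪c, v⟫_ℝ = 5 / 6 := by rw [real_inner_comm]; exact hvc
  rw [real_inner_smul_right, real_inner_smul_right, inner_add_right, inner_add_right, hcv, hcc]
  have hinv : 0 < ‖v + c‖⁻¹ := inv_pos.2 hpos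
  have hlt : ⟪q, v⟫_ℝ + ⟪q, c⟫_ℝ < 5 / 6 + 1 := by linarith
  exact mul_lt_mul_of_pos_left hlt hinv

/-! ### Forcing `bestCapper` -/

/-- **A positive slot that strictly beats every other positive slot in `z`-height is `bestCapper`.** -/
theorem bestCapper_eq_of_strict (F' : EuclideanSpace ℝ (Fin 3) ≃ₗᵢ[ℝ] EuclideanSpace ℝ (Fin 3))
    (n z : EuclideanSpace ℝ (Fin 3)) {c : EuclideanSpace ℝ (Fin 3)} (hc : c ∈ fccSlots) (hcn : 0 < ⟪F' c, n⟫_ℝ)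
    (hstrict : ∀ q ∈ fccSlots, 0 < ⟪F' q, n⟫_ℝ → q ≠ c → ⟪F' q, z⟫_ℝ < ⟪F' c, z⟫_ℝ) :
    bestCapper F' n z = c := by
  classical
  have hne : (fccSlots.filter fun q => 0 < ⟪F' q, n⟫_ℝ).Nonempty := ⟨c, mem_filter.2 ⟨hc, hcn⟩⟩
  obtain ⟨hmem, hmax⟩ := bestCapper_spec F' n z hne
  obtain ⟨hslot, hpos⟩ := mem_filter.1 hmem
  by_contra hneq
  have h1 := hstrict _ hslot hpos hneq
  have h2 := hmax c (mem_filter.2 ⟨hc, hcn⟩)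
  linarith

/-- **The swept steering selects the adjacent capper.**  `F'` a frame, `n` its cap normal, `c` a positive slot
(`0 < ⟪F' c, n⟫`, `‖F' c‖ = 1` automatic), `v` the unit incoming direction with `⟪v, F' c⟫ = 5/6`; if every OTHER
positive slot `q` has `⟪F' q, v⟫ ≤ 5/6` and `⟪F' q, F' c⟫ ≤ 1/2`, then `bestCapper F' n z′ = c` for the swept steering
`z′ = (v + F' c)/‖v + F' c‖`. -/
theorem bestCapper_eq_of_swept_steering (F' : EuclideanSpace ℝ (Fin 3) ≃ₗᵢ[ℝ] EuclideanSpace ℝ (Fin 3))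
    (n : EuclideanSpace ℝ (Fin 3)) {v c : EuclideanSpace ℝ (Fin 3)} (hv : ‖v‖ = 1) (hc : c ∈ fccSlots)
    (hcn : 0 < ⟪F' c, n⟫_ℝ) (hvc : ⟪v, F' c⟫_ℝ = 5 / 6)
    (hothers : ∀ q ∈ fccSlots, 0 < ⟪F' q, n⟫_ℝ → q ≠ c → ⟪F' q, v⟫_ℝ ≤ 5 / 6 ∧ ⟪F' q, F' c⟫_ℝ ≤ 1 / 2) :
    bestCapper F' n ((‖v + F' c‖⁻¹ : ℝ) • (v + F' c)) = c := by
  have hFc : ‖F' c‖ = 1 := by rw [LinearIsometryEquiv.norm_map, norm_eq_one_of_mem_fccSlots hc]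
  refine bestCapper_eq_of_strict F' n _ hc hcn fun q hq hqn hqc => ?_
  obtain ⟨h1, h2⟩ := hothers q hq hqn hqc
  exact inner_lt_of_swept_steering hv hFc hvc h1 h2

/-! ### The forced next normal of an in-plane capper -/

/-- **`⟪F d, nextNormal e⟫ = √(2/3)`** for an entry with unit direction and `⟪F d, n⟫ = √(2/3)`: the forced next normal
makes the direction positive (it is the OTHER normal of the menu doing so). -/
theorem inner_dir_nextNormal (e : WalkEntry) (hd : ‖e.frame e.dir‖ = 1)
    (hpos : ⟪e.frame e.dir, e.nrm⟫_ℝ = Real.sqrt (2 / 3)) :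
    ⟪e.frame e.dir, nextNormal e⟫_ℝ = Real.sqrt (2 / 3) := by
  have hdd : ⟪e.frame e.dir, e.frame e.dir⟫_ℝ = 1 := by rw [real_inner_self_eq_norm_sq, hd, one_pow]
  rw [nextNormal, inner_sub_right, real_inner_smul_right, hdd, hpos]
  ring

/-- **An in-plane capper never forces the mirror `m`**: if `⟪F d, m⟫ = 0` then `nextNormal e ≠ m`. -/
theorem nextNormal_ne_of_inner_eq_zero (e : WalkEntry) (hd : ‖e.frame e.dir‖ = 1)
    (hpos : ⟪e.frame e.dir, e.nrm⟫_ℝ = Real.sqrt (2 / 3)) {m : EuclideanSpace ℝ (Fin 3)}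
    (hm : ⟪e.frame e.dir, m⟫_ℝ = 0) : nextNormal e ≠ m := by
  intro h
  have h1 := inner_dir_nextNormal e hd hpos
  rw [h, hm] at h1
  have h2 : 0 < Real.sqrt (2 / 3) := Real.sqrt_pos.2 (by norm_num)
  linarith

/-- … nor its opposite: `nextNormal e ≠ −m`. -/
theorem nextNormal_ne_neg_of_inner_eq_zero (e : WalkEntry) (hd : ‖e.frame e.dir‖ = 1)
    (hpos : ⟪e.frame e.dir, e.nrm⟫_ℝ = Real.sqrt (2 / 3)) {m : EuclideanSpace ℝ (Fin 3)}
    (hm : ⟪e.frame e.dir, m⟫_ℝ = 0) : nextNormal e ≠ -m := by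
  have hm' : ⟪e.frame e.dir, -m⟫_ℝ = 0 := by rw [inner_neg_right, hm, neg_zero]
  exact nextNormal_ne_of_inner_eq_zero e hd hpos hm'

/-- **Level one of a swept ray does not mirror across `m`.**  For the ray over the bottom `b` with first push normal
`n`: if the level-`0` capper `d₀ = bestCapper (twinFrame b.frame n) n z` is a slot, `n`-positive with the exact value
`√(2/3)`, and in-plane for `m`, then the level-`1` entry normal (`= nextNormal` of level `0`) is neither `m` nor `−m`. -/
theorem forcedTop_one_nrm_ne (z : EuclideanSpace ℝ (Fin 3)) (b : WalkEntry) (n m : EuclideanSpace ℝ (Fin 3))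
    (hd : (forcedTop z b n 0).dir ∈ fccSlots)
    (hpos : ⟪(forcedTop z b n 0).frame (forcedTop z b n 0).dir, n⟫_ℝ = Real.sqrt (2 / 3))
    (hm : ⟪(forcedTop z b n 0).frame (forcedTop z b n 0).dir, m⟫_ℝ = 0) :
    (forcedTop z b n 1).nrm ≠ m ∧ (forcedTop z b n 1).nrm ≠ -m := by
  have hunit : ‖(forcedTop z b n 0).frame (forcedTop z b n 0).dir‖ = 1 := by
    rw [LinearIsometryEquiv.norm_map, norm_eq_one_of_mem_fccSlots hd]
  have hnrm0 : (forcedTop z b n 0).nrm = n := forcedTop_nrm_zero z b n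
  have hpos' : ⟪(forcedTop z b n 0).frame (forcedTop z b n 0).dir, (forcedTop z b n 0).nrm⟫_ℝ = Real.sqrt (2 / 3) := by
    rw [hnrm0]; exact hpos
  have h1 : (forcedTop z b n 1).nrm = nextNormal (forcedTop z b n 0) := by
    rw [forcedTop_succ]; rfl
  rw [h1]
  exact ⟨nextNormal_ne_of_inner_eq_zero _ hunit hpos' hm, nextNormal_ne_neg_of_inner_eq_zero _ hunit hpos' hm⟩

end Summit.Ventures.Crystal3D.Theorems

end
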